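import Mathlib.Algebra.Category.Grp.Basic
import Mathlib.Algebra.Group.Subgroup.Lattice
import Mathlib.Algebra.Field.Defs
import Mathlib.Algebra.Group.TypeTags.Hom
import Mathlib.Algebra.Module.LinearMap.Defs
import Mathlib.GroupTheory.OrderOfElement
import Mathlib.LinearAlgebra.FreeModule.Basic
import Mathlib.LinearAlgebra.TensorProduct.Associator
import Mathlib.LinearAlgebra.TensorProduct.Map
import Mathlib.RingTheory.Finiteness.Defs
import HarnessLib

/-!
# Kottwitz 1984 (Math. Ann.), §3: construction of the homomorphism `λ : G(F) → X^*(Z(Ĝ))^Γ` (typed skeleton)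

R. E. Kottwitz, *Shimura varieties and twisted orbital integrals*, Math. Ann. 269 (1984) 287–300 [Kottwitz1984TwistedOrbital],
§3 «Construction of the homomorphism `λ`», pp. 298–299 (open GDZ digitisation PPN235181684_0269 / LOG_0031, lit key
`paper:url-15572740aaa4`; statements read on the page IMAGES of pp. 298–299, canvas = printed page + 4; cell folder
`T/KOT/TK-t08/g0/Kottwitz1984TwistedOrbital-GDZ/`).  Quotations AS PRINTED.  Carpet file of squad TK (cell `pub/hodgecm-mathlib`, seat
TK-t08): STATEMENTS ONLY — no proof, no `sorry`, no axiom, no instance, no notation.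

WHAT IS TYPED, AND HOW.  The paper phrases Lemma 3.3 functorially («the two functors `G ↦ G(F)` and `G ↦ X^*(Z(Ĝ))^Γ` from the
category of unramified connected reductive `F`-groups and normal homomorphisms to the category of groups», «a homomorphism of
functors»), so the skeleton is Mathlib category theory: a hypothesis structure `LambdaDatum U` over a category `U` (the unramified
groups with normal homomorphisms) carrying two functors `Pts`, `Ctr : U ⥤ GrpCat` and the data Lemma 3.3 speaks about (the torus
objects with their homomorphisms (3.2), the unramified maximal tori `T ⊂ G` with the two NON-functorial arrows of (3.3.2), the special
maximal compact subgroups `K ⊂ G(F)`); **Lemma 3.3** is the predicate `LambdaDatum.Lemma33` (existence and uniqueness of the natural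
transformation extending (3.2); surjectivity; the square (3.3.2); triviality on `K`), and (3.1) is `LambdaDatum.Surj31`.  NOTHING IS
ASSERTED (a consumer takes `(h : D.P)`).  The two group-theoretic steps (3.3.3), (3.3.4) of the proof are typed CONCRETELY for abstract
groups (`Eq333`, `Eq334`).

THE PRINT.  (p. 298) «In this section `F` is a non-archimedean local field, and `F̄`, `F^un`, `Γ` have the same meaning as in §2. For any
unramified `F`-torus `T` there is a surjective homomorphism (3.1) `T(F) → X_*(T)^Γ`, obtained by tensoring the normalized valuation
`(F^un)^× → ℤ` with `X_*(T)` and taking invariants under `Γ`. But `X_*(T)^Γ = X^*(T̂)^Γ`, and thus we can regard (3.1) as homomorphism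
(3.2) `λ : T(F) → X^*(T̂)^Γ`, functorial in `T`. To prevent confusion we sometimes write `λ_T` instead of `λ`. Now consider the two
functors `G ↦ G(F)` and `G ↦ X^*(Z(Ĝ))^Γ` from the category of unramified connected reductive `F`-groups and normal homomorphisms to the
category of groups (we are using notation and terminology from [K3]). (3.3) Lemma. There exists a unique extension of (3.2) to a
homomorphism of functors (3.3.1) `λ : G(F) → X^*(Z(Ĝ))^Γ`. For all `G` the homomorphism `λ_G` is surjective. For any unramified maximal
`F`-torus `T` of `G`, the following diagram commutes: (3.3.2) [`T(F) → G(F)`, `λ_T ↓`, `↓ λ_G`, `X^*(T̂)^Γ → X^*(Z(Ĝ))^Γ`]. The restriction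
of `λ_G` to any special maximal compact subgroup `K` of `G(F)` is trivial.»  (p. 299, proof) «Since `T → G` is not a normal homomorphism
(unless `G` is a torus), the functoriality of `λ` does not apply to this situation. […] Finally, we prove that `λ` is trivial on `K`. The
group `K` is the stabilizer in `G(F)` of some special point `x₀` in the building `𝓑` of `G`. Choose a maximal `F`-split torus `S` of `G`
whose apartment contains `x₀`, and let `T` denote the centralizer of `S` in `G`. Let `p : G_sc → G` be the simply connected cover of the
derived group of `G`. Our first step is to show that (3.3.3) `G(F) = p(G_sc(F))·T(F)`. […] Let `K_sc` denote the stabilizer of `x₀` in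
`G_sc(F)`. Our next step is to show that (3.3.4) `K = p(K_sc)·T(F)₀`, where `T(F)₀` denotes `T(F) ∩ K`.»

NOT typed: the construction itself (first for `G_der` simply connected via `D = G/G_der`, `D̂ = Z(Ĝ)`, then via `z`-extensions
`1 → Z → H → G → 1` and the vanishing of `H¹(F, X^*(Ẑ))`, p. 298), and the identification `X_*(T)^Γ = X^*(T̂)^Γ`.  HC_CM is proved only
modulo the printed citations until rung 0 closes; this file discharges none of them.

## References
* [Kottwitz1984TwistedOrbital] R. E. Kottwitz, *Shimura varieties and twisted orbital integrals*, Math. Ann. 269 (1984) 287–300, §3: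
  (3.1), (3.2), Lemma 3.3 with (3.3.1), (3.3.2) p. 298; (3.3.3), (3.3.4) p. 299.
* [K3] = R. E. Kottwitz, *Stable trace formula: cuspidal tempered terms*, Duke Math. J. 51 (1984) («notation and terminology», normal
  homomorphisms; Lemma 2.4.4) — quoted, not read here (tree key `Kottwitz1984`).
-/

open CategoryTheory

namespace Literature.NumberTheory.Kottwitz1984TwistedOrbital.LambdaHomomorphism

universe u v w

/-! ## Lemma 3.3 as a statement about two functors to the category of groups -/

/-- **Carriers for §3** (p. 298).  `U` is the category of unramified connected reductive `F`-groups and normal homomorphisms.  Fields: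
* `Pts : U ⥤ GrpCat` — `G ↦ G(F)`; `Ctr : U ⥤ GrpCat` — `G ↦ X^*(Z(Ĝ))^Γ` (an abelian group, here in `GrpCat`);
* `IsTorus T` — the object `T` is an (unramified) torus; `lamT T hT : T(F) ⟶ X^*(T̂)^Γ` — the homomorphism (3.2) = (3.1) (for a torus
  `Z(T̂) = T̂`);
* `MaxTorus G` — the unramified maximal `F`-tori `T` of `G`, with `torusObj t : U` the torus as an object, `inclPts t : T(F) ⟶ G(F)` and
  `inclCtr t : X^*(T̂)^Γ ⟶ X^*(Z(Ĝ))^Γ` the two horizontal arrows of (3.3.2) (NOT images of morphisms of `U`: «`T → G` is not a normal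
  homomorphism (unless `G` is a torus)», p. 299);
* `SpecialMaxCompact G` — the special maximal compact subgroups `K` of `G(F)`, `carrierK K ⊆ G(F)` its underlying set.
[cite: Kottwitz1984TwistedOrbital, §3 (p. 298)] -/
structure LambdaDatum (U : Type u) [Category.{v} U] where
  /-- `G ↦ G(F)` -/
  Pts : U ⥤ GrpCat.{w}
  /-- `G ↦ X^*(Z(Ĝ))^Γ` -/
  Ctr : U ⥤ GrpCat.{w}
  /-- `T` is a torus -/
  IsTorus : U → Prop
  /-- (3.2) `λ_T : T(F) → X^*(T̂)^Γ` -/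
  lamT : (T : U) → IsTorus T → (Pts.obj T ⟶ Ctr.obj T)
  /-- unramified maximal `F`-tori of `G` -/
  MaxTorus : U → Type w
  /-- the torus as an object of `U` -/
  torusObj : {G : U} → MaxTorus G → U
  /-- it is a torus -/
  torusObj_isTorus : ∀ {G : U} (t : MaxTorus G), IsTorus (torusObj t)
  /-- `T(F) → G(F)` -/
  inclPts : {G : U} → (t : MaxTorus G) → (Pts.obj (torusObj t) ⟶ Pts.obj G)
  /-- `X^*(T̂)^Γ → X^*(Z(Ĝ))^Γ` -/
  inclCtr : {G : U} → (t : MaxTorus G) → (Ctr.obj (torusObj t) ⟶ Ctr.obj G)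
  /-- special maximal compact subgroups `K ⊆ G(F)` -/
  SpecialMaxCompact : U → Type w
  /-- the underlying set of `K` -/
  carrierK : {G : U} → SpecialMaxCompact G → Set (Pts.obj G)

namespace LambdaDatum

variable {U : Type u} [Category.{v} U]

/-- **(3.1)** (p. 298): «For any unramified `F`-torus `T` there is a surjective homomorphism `T(F) → X_*(T)^Γ`» (= (3.2) `λ_T`).
Nothing is asserted. [cite: Kottwitz1984TwistedOrbital, (3.1)–(3.2) (p. 298)] -/
def Surj31 (D : LambdaDatum.{u, v, w} U) : Prop :=
  ∀ (T : U) (hT : D.IsTorus T), Function.Surjective (D.lamT T hT).hom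

/-- A natural transformation `λ : Pts ⟶ Ctr` EXTENDS (3.2): its components at torus objects are the `λ_T`.
[cite: Kottwitz1984TwistedOrbital, Lemma 3.3 (p. 298)] -/
def Extends (D : LambdaDatum.{u, v, w} U) (lam : D.Pts ⟶ D.Ctr) : Prop :=
  ∀ (T : U) (hT : D.IsTorus T), lam.app T = D.lamT T hT

/-- **[Kottwitz1984TwistedOrbital, Lemma 3.3]** (p. 298), AS PRINTED: «There exists a unique extension of (3.2) to a homomorphism of
functors (3.3.1) `λ : G(F) → X^*(Z(Ĝ))^Γ`. For all `G` the homomorphism `λ_G` is surjective. For any unramified maximal `F`-torus `T` of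
`G`, the following diagram commutes: (3.3.2) [`λ_G ∘ (T(F) → G(F)) = (X^*(T̂)^Γ → X^*(Z(Ĝ))^Γ) ∘ λ_T`]. The restriction of `λ_G` to any special
maximal compact subgroup `K` of `G(F)` is trivial.»  TYPED: there is exactly one natural transformation `Pts ⟶ Ctr` extending the
`λ_T`, and every such extension has surjective components, makes the squares (3.3.2) commute, and kills every `K`.  Nothing is asserted.
[cite: Kottwitz1984TwistedOrbital, Lemma 3.3 (p. 298)] -/
def Lemma33 (D : LambdaDatum.{u, v, w} U) : Prop :=
  (∃! lam : D.Pts ⟶ D.Ctr, D.Extends lam) ∧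
    ∀ lam : D.Pts ⟶ D.Ctr, D.Extends lam →
      (∀ G : U, Function.Surjective (lam.app G).hom) ∧
        (∀ (G : U) (t : D.MaxTorus G), D.inclPts t ≫ lam.app G = lam.app (D.torusObj t) ≫ D.inclCtr t) ∧
          ∀ (G : U) (K : D.SpecialMaxCompact G), ∀ k ∈ D.carrierK K, (lam.app G).hom k = 1

end LambdaDatum

/-! ## The two group-theoretic steps (3.3.3), (3.3.4) of the proof, concretely -/

section Steps

variable {Gsc : Type u} {GF : Type v} [Group Gsc] [Group GF]

/-- **(3.3.3)** (p. 299): «`G(F) = p(G_sc(F))·T(F)`», for the simply connected cover `p : G_sc → G` of the derived group and the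
centralizer `T` of a maximal `F`-split torus whose apartment contains the special point `x₀`.  TYPED for a homomorphism `p : Gsc →* GF`
(on `F`-points) and a subgroup `T ≤ GF`: every element of `GF` is `p(x)·t`.  Nothing is asserted.
[cite: Kottwitz1984TwistedOrbital, (3.3.3) (p. 299)] -/
def Eq333 (p : Gsc →* GF) (T : Subgroup GF) : Prop :=
  ∀ g : GF, ∃ x : Gsc, ∃ t ∈ T, g = p x * t

/-- **(3.3.4)** (p. 299): «`K = p(K_sc)·T(F)₀`, where `T(F)₀` denotes `T(F) ∩ K`», `K_sc` the stabilizer of `x₀` in `G_sc(F)`.  TYPED for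
`p : Gsc →* GF`, subgroups `T, K ≤ GF`, `Ksc ≤ Gsc`: `K` is exactly the set of products `p(x)·t`, `x ∈ Ksc`, `t ∈ T ∩ K`.  Nothing is asserted.
[cite: Kottwitz1984TwistedOrbital, (3.3.4) (p. 299)] -/
def Eq334 (p : Gsc →* GF) (T K : Subgroup GF) (Ksc : Subgroup Gsc) : Prop :=
  ∀ k : GF, k ∈ K ↔ ∃ x ∈ Ksc, ∃ t ∈ T ⊓ K, k = p x * t

end Steps

/-! ## ED. 2 (TK-t03): the torus statements (3.1), (3.2) CONCRETELY, in the cocharacter-lattice model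

MODEL (appended by TK-t03, DEAL v3.1 (3)(i); ED. 1 above is TK-t08's and is unchanged): an unramified `F`-torus `T` is its
cocharacter lattice `Y = X_*(T)` (finitely generated free `ℤ`-module) with the automorphism `τ` through which the arithmetic
Frobenius `σ ∈ Gal(F^un/F)` acts (`Γ` acts on `X_*(T)` through `Gal(F^un/F) = ⟨σ⟩^∧`, so `X_*(T)^Γ = Y^τ`); `F^un` is a field `Fun`
with `σ : Fun ≃+* Fun` and the normalized valuation `v` (`IsFrobValDatum`); `T(F^un) = X_*(T) ⊗ (F^un)^×` is
`Y ⊗[ℤ] Additive Funˣ` with `σ_T = τ ⊗ σ`, `T(F) = T(F^un)^σ`; «tensoring the normalized valuation with `X_*(T)`» is `valMap`.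
In this model `X^*(T̂) = X_*(T)` by definition of `T̂`, so (3.2) `λ_T` IS (3.1); this is the concrete instance of ED. 1's
abstract `LambdaDatum.lamT` ∕ `Surj31` for tori (ED. 1: «NOT typed: … the identification `X_*(T)^Γ = X^*(T̂)^Γ`»).  It is the
unramified special case of the Galois-lattice model of `Literature.NumberTheory.Kottwitz1992.FunctorialIsomorphisms` (TK-t05,
COinvariants and `B(T)`); here INvariants and the valuation — a different functor, nothing restated. -/

section Torus

open scoped TensorProduct

variable (Fun : Type u) [Field Fun] (σ : Fun ≃+* Fun) (v : Additive Funˣ →+ ℤ)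

/-- `(F^un, σ, v)` models «`F^un`» with the Frobenius generator `σ` of `Gal(F^un/F)` and «the normalized valuation
`(F^un)^× → ℤ`» (p. 298): `v` is a surjective homomorphism, `σ`-invariant (`σ` preserves the valuation), and the
fixed field `F = (F^un)^σ` contains a uniformizer (`F^un/F` unramified).  A MODEL of the printed objects: the facts
below are predicates on such data and are not asserted. [cite: Kottwitz1984TwistedOrbital, §3 (p. 298)] -/
structure IsFrobValDatum : Prop where
  /-- the valuation is normalized: onto `ℤ` -/
  surjective : Function.Surjective v
  /-- `v(σ x) = v(x)` -/
  frob_inv : ∀ x : Funˣ, v (Additive.ofMul (Units.map (σ : Fun →* Fun) x)) = v (Additive.ofMul x)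
  /-- `F^un / F` is unramified: `F = (F^un)^σ` already contains a uniformizer (`v` is normalized on `F` too) -/
  exists_uniformizer : ∃ x : Funˣ, σ (x : Fun) = x ∧ v (Additive.ofMul x) = 1

/-- `σ` acting on `(F^un)^×`, as a `ℤ`-linear map of `Additive (F^un)^×`. [cite: Kottwitz1984TwistedOrbital, §3 (p. 298)] -/
noncomputable def unitsFrob : Additive Funˣ →ₗ[ℤ] Additive Funˣ :=
  (MonoidHom.toAdditive (Units.map (σ : Fun →* Fun))).toIntLinearMap

variable (Y : Type v) [AddCommGroup Y] (τ : Y ≃ₗ[ℤ] Y)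

/-- `T(F^un) = X_*(T) ⊗_ℤ (F^un)^×` for the unramified torus `T` with cocharacter lattice `Y = X_*(T)` (split over
`F^un`). [cite: Kottwitz1984TwistedOrbital, §3 (p. 298)] -/
abbrev PointsFun : Type (max u v) :=
  Y ⊗[ℤ] Additive Funˣ

/-- The Frobenius `σ_T = τ ⊗ σ` on `T(F^un) = X_*(T) ⊗ (F^un)^×` (`τ` = the action of `σ` on `X_*(T)`).
[cite: Kottwitz1984TwistedOrbital, §3 (p. 298)] -/
noncomputable def frobPoints : PointsFun Fun Y →ₗ[ℤ] PointsFun Fun Y :=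
  TensorProduct.map τ.toLinearMap (unitsFrob Fun σ)

/-- `T(F) = T(F^un)^Γ`, the `σ`-fixed points of `T(F^un)` («taking invariants under `Γ`», p. 298; `Γ` acts through
`Gal(F^un/F) = ⟨σ⟩^∧` on the discrete module `T(F^un)`). [cite: Kottwitz1984TwistedOrbital, §3 (p. 298)] -/
noncomputable def ratPoints : Submodule ℤ (PointsFun Fun Y) :=
  LinearMap.ker (frobPoints Fun σ Y τ - LinearMap.id)

/-- `X_*(T)^Γ = Y^τ` (and `= X^*(T̂)^Γ`, since `X^*(T̂) = X_*(T)` by definition of the dual torus `T̂`).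
[cite: Kottwitz1984TwistedOrbital, §3 (p. 298)] -/
def invariants : Submodule ℤ Y :=
  LinearMap.ker (τ.toLinearMap - LinearMap.id)

/-- «tensoring the normalized valuation `(F^un)^× → ℤ` with `X_*(T)`» (p. 298): the map
`X_*(T) ⊗ (F^un)^× → X_*(T) ⊗ ℤ = X_*(T)`, `y ⊗ x ↦ v(x) y`. [cite: Kottwitz1984TwistedOrbital, (3.1) (p. 298)] -/
noncomputable def valMap : PointsFun Fun Y →ₗ[ℤ] Y :=
  (TensorProduct.rid ℤ Y).toLinearMap ∘ₗ TensorProduct.map LinearMap.id v.toIntLinearMap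

/-- Membership in `T(F) = ratPoints`: `x` is fixed by `σ_T = τ ⊗ σ`. [cite: Kottwitz1984TwistedOrbital, §3 (p. 298)] -/
theorem mem_ratPoints_iff (x : PointsFun Fun Y) :
    x ∈ ratPoints Fun σ Y τ ↔ frobPoints Fun σ Y τ x = x := by
  simp [ratPoints, sub_eq_zero]

/-- Membership in `X_*(T)^Γ = invariants`: `τ y = y`. [cite: Kottwitz1984TwistedOrbital, §3 (p. 298)] -/
theorem mem_invariants_iff (y : Y) : y ∈ invariants Y τ ↔ τ y = y := by
  simp [invariants, sub_eq_zero]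

/-- `valMap` intertwines the Frobenius of `T(F^un)` with `τ` as soon as `v` is `σ`-invariant:
`(v ⊗ 1) ∘ (τ ⊗ σ) = τ ∘ (v ⊗ 1)`. [cite: Kottwitz1984TwistedOrbital, (3.1) (p. 298)] -/
theorem valMap_comp_frobPoints
    (hv : ∀ x : Funˣ, v (Additive.ofMul (Units.map (σ : Fun →* Fun) x)) = v (Additive.ofMul x)) :
    valMap Fun v Y ∘ₗ frobPoints Fun σ Y τ = τ.toLinearMap ∘ₗ valMap Fun v Y := by
  apply TensorProduct.ext'
  intro y x
  have hx : v (unitsFrob Fun σ x) = v x := hv (Additive.toMul x)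
  simp [valMap, frobPoints, hx]

/-- **[Kottwitz1984TwistedOrbital, (3.1) (p. 298)]**, verbatim: «For any unramified `F`-torus `T` there is a surjective
homomorphism (3.1) `T(F) → X_*(T)^Γ`, obtained by tensoring the normalized valuation `(F^un)^× → ℤ` with `X_*(T)` and
taking invariants under `Γ`.»  In the lattice model (for `(F^un, σ, v)` as in `IsFrobValDatum`, any `(Y, τ)`):
`valMap` carries `T(F) = ratPoints` INTO and ONTO `X_*(T)^Γ = invariants τ` (a `τ`-fixed `y` is hit by
`y ⊗ ϖ`, `ϖ` a uniformizer of `F`).  By «`X_*(T)^Γ = X^*(T̂)^Γ`» this restricted map IS (3.2)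
`λ_T : T(F) → X^*(T̂)^Γ`.  PROVED in the model (gate review of ED. 2: provable statements are theorems, D-0026 (iv)).
[cite: Kottwitz1984TwistedOrbital, (3.1) (p. 298)] -/
theorem Kottwitz1984_3_1_surjective (hD : IsFrobValDatum Fun σ v) :
    (∀ x ∈ ratPoints Fun σ Y τ, valMap Fun v Y x ∈ invariants Y τ) ∧
    ∀ y ∈ invariants Y τ, ∃ x ∈ ratPoints Fun σ Y τ, valMap Fun v Y x = y := by
  refine ⟨fun x hx => ?_, fun y hy => ?_⟩
  · rw [mem_ratPoints_iff] at hx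
    rw [mem_invariants_iff]
    have h := congrArg (fun f => f x) (valMap_comp_frobPoints Fun σ v Y τ hD.frob_inv)
    simp only [LinearMap.coe_comp, Function.comp_apply, LinearEquiv.coe_coe] at h
    rw [hx] at h
    exact h.symm
  · obtain ⟨x0, hx0, hv0⟩ := hD.exists_uniformizer
    rw [mem_invariants_iff] at hy
    have hu : Units.map (σ : Fun →* Fun) x0 = x0 := Units.ext (by simpa using hx0)
    refine ⟨y ⊗ₜ Additive.ofMul x0, ?_, ?_⟩
    · rw [mem_ratPoints_iff]
      simp [frobPoints, unitsFrob, hy, hu]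
    · simp [valMap, hv0]

variable (Y' : Type v) [AddCommGroup Y'] (τ' : Y' ≃ₗ[ℤ] Y')

/-- **[Kottwitz1984TwistedOrbital, (3.2) (p. 298)] «functorial in `T`»**: for a homomorphism of unramified tori
`T → T'` — a `ℤ`-linear `φ : X_*(T) → X_*(T')` commuting with the Frobenius actions — `φ ⊗ 1` carries `T(F)` into
`T'(F)` and `λ_{T'} ∘ (φ ⊗ 1) = φ ∘ λ_T` (on all of `T(F^un)`).  PROVED in the model (tensor-product naturality).
[cite: Kottwitz1984TwistedOrbital, (3.2) (p. 298)] -/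
theorem Kottwitz1984_3_2_functorial (φ : Y →ₗ[ℤ] Y') (hφ : φ ∘ₗ τ.toLinearMap = τ'.toLinearMap ∘ₗ φ) :
    (∀ x ∈ ratPoints Fun σ Y τ, TensorProduct.map φ LinearMap.id x ∈ ratPoints Fun σ Y' τ') ∧
    valMap Fun v Y' ∘ₗ TensorProduct.map φ (LinearMap.id : Additive Funˣ →ₗ[ℤ] Additive Funˣ) =
      φ ∘ₗ valMap Fun v Y := by
  refine ⟨fun x hx => ?_, ?_⟩
  · rw [mem_ratPoints_iff] at hx ⊢
    have key : frobPoints Fun σ Y' τ' ∘ₗ TensorProduct.map φ LinearMap.id =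
        TensorProduct.map φ LinearMap.id ∘ₗ frobPoints Fun σ Y τ := by
      apply TensorProduct.ext'
      intro y u
      have := congrArg (fun f => f y) hφ
      simp only [LinearMap.coe_comp, Function.comp_apply, LinearEquiv.coe_coe] at this
      simp [frobPoints, this]
    have h := congrArg (fun f => f x) key
    simp only [LinearMap.coe_comp, Function.comp_apply] at h
    rw [h, hx]
  · apply TensorProduct.ext'
    intro y u
    simp [valMap]

end Torus


end Literature.NumberTheory.Kottwitz1984TwistedOrbital.LambdaHomomorphism
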